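import Literature.AlgebraicGeometry.ShimuraVarieties.UnitaryShimuraCurveEmbeddingDescent
import Literature.AlgebraicGeometry.ShimuraVarieties.UnitaryShimuraCurveEmbeddingComplex
import HarnessLib

/-!
# u2 of the GS-3 cluster is a THEOREM: the embedding `Sh(U(J⋆), 𝔻) → Sh(U(H), 𝔹²)` is defined over the reflex field
# ([Deligne 1979] 2.2.6 / [Milne 2005] Thm. 13.7–Rem. 13.8 / [Liu 2021] proof of Thm. 4.15)

Topic `AlgebraicGeometry/ShimuraVarieties`, namespace `…ShimuraVarieties.UnitaryCanonicalModel`. THEOREMS ONLY (no definition, no named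
fact, no instance, no `sorry`).  The conjunct u2 `S⋆.EmbeddingDefinedOver S J⊥ B ha hB hτa hτa'` of the named fact ★ `exists_recordSystemGS`
(GS-3, `UnitaryShimuraCurveCanonicalModelExists` :223–230) holds for EVERY curve record `S⋆ : RecordSystemGS L J⋆ τ K₀⋆` and EVERY rank-3
record `S : RecordSystem L H τ T hT K₀` along a frame `ᵗ(cB)·(a·H)·B = J⋆ ⊕ J⊥` (`τ a` a positive real), for `J⋆` `c`-hermitian and
non-degenerate: the COMPLEX half ★ `RecordSystemGS.exists_embeddingComplex` (`UnitaryShimuraCurveEmbeddingComplex`: the sub-ball inclusion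
is a `ℂ`-morphism of the complex fibres, piece by piece by GAGA) fed to the DESCENT half ★ `RecordSystemGS.embeddingDefinedOver_of_complex`
(`UnitaryShimuraCurveEmbeddingDescent`: Prop. 13.1 + reciprocity at one CM point + density).  No hypothesis of ★ `exists_recordSystemGS` is
used: the records' own fields suffice (as for the rank-3 u1 ★ `heckeTranslate_definedOver_holds`).

## References
* [Deligne1979ShimuraVarieties] P. Deligne, *Variétés de Shimura* (1979), 2.2.6, Cor. 2.7.21.
* [Milne2005ShimuraVarieties] J. S. Milne, *Introduction to Shimura varieties* (2005; rev. 2017), Prop. 13.1 p. 117, Thm. 13.6 p. 118,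
  Thm. 13.7 / Rem. 13.8 p. 119.
* [Liu2021] Y. Liu, Camb. J. Math. 9 (2021), proof of Thm. 4.15 (FJcycle.tex l. 2193–2208).
-/

set_option autoImplicit false

noncomputable section

open NumberField Matrix
open scoped Matrix ComplexOrder
open Literature.NumberTheory.Automorphic Literature.NumberTheory.Automorphic.UnitaryGroup
open Literature.NumberTheory.Automorphic.Liu2021.AppendixC (C5.OpenCompactSubgroup C5.SmallLevel)
open Literature.Geometry.ComplexHyperbolic

namespace Literature.AlgebraicGeometry.ShimuraVarieties.UnitaryCanonicalModel

variable {L : Type} [Field L] [NumberField L] [IsCMField L] {Jstar : Matrix (Fin 2) (Fin 2) L} {τ : L →+* ℂ}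
  {K₀ : C5.OpenCompactSubgroup ↥(finAdelic (↥(maximalRealSubfield L)) L (IsCMField.complexConj L) 2 Jstar)}
  {H : Matrix (Fin 3) (Fin 3) L} {T : GL (Fin 3) ℂ} {hT : formCongr (starRingEnd ℂ) T (H.map τ) = BallModel.J}
  {K₀' : C5.OpenCompactSubgroup ↥(finAdelic (↥(maximalRealSubfield L)) L (IsCMField.complexConj L) 3 H)}

/-- **u2 holds ([Deligne1979ShimuraVarieties] 2.2.6 / [Milne2005ShimuraVarieties] Thm. 13.7–Rem. 13.8 for the pair of canonical models
`Sh(U(J⋆), 𝔻) → Sh(U(H), 𝔹²)`; [Liu2021] proof of Thm. 4.15, «the morphism `Sh(G⋆, h⋆) → Sh(G, h)` over `E`»)**: for the curve record `S⋆`,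
the rank-3 record `S`, a frame `ᵗ(cB)·(a·H)·B = J⋆ ⊕ J⊥` (`τ a` a positive real) and `J⋆` `c`-hermitian non-degenerate, the embedding is
DEFINED OVER `L`: ★ `S⋆.EmbeddingDefinedOver S J⊥ B ha hB hτa hτa'` — the complex half ★ `RecordSystemGS.exists_embeddingComplex` fed to the
descent ★ `RecordSystemGS.embeddingDefinedOver_of_complex`. [cite: Deligne1979ShimuraVarieties, 2.2.6 and Cor. 2.7.21]
[cite: Milne2005ShimuraVarieties, Thm. 13.7 and Rem. 13.8 p. 119; Thm. 13.6 p. 118] [cite: Liu2021, Thm. 4.15 proof (FJcycle.tex l. 2193–2208)] -/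
theorem RecordSystemGS.embeddingDefinedOver_holds (Sstar : RecordSystemGS L Jstar τ K₀) (S : RecordSystem L H τ T hT K₀')
    (Jperp : Matrix (Fin 1) (Fin 1) L) (B : GL (Fin 3) L) {a : L} (ha : a ≠ 0)
    (hB : formCongr ((IsCMField.complexConj L : L ≃ₐ[↥(maximalRealSubfield L)] L) : L →+* L) B (a • H) = finSum 2 1 Jstar Jperp)
    (hτa : 0 < (τ a).re) (hτa' : (τ a).im = 0) (hJ : (Jstar.map (IsCMField.complexConj L))ᵀ = Jstar) (hdet : IsUnit Jstar.det) :
    Sstar.EmbeddingDefinedOver S Jperp B ha hB hτa hτa' :=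
  Sstar.embeddingDefinedOver_of_complex S Jperp B ha hB hτa hτa' hJ hdet fun Kstar K hK =>
    Sstar.exists_embeddingComplex S Jperp B ha hB hτa hτa' Kstar K hK

end Literature.AlgebraicGeometry.ShimuraVarieties.UnitaryCanonicalModel

end
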